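import Summits.NavierStokesRegularity.NavierStokesRegularity.Theses.TypeILiouville
import Literature.Analysis.FluidPDE.AncientL3BackwardLiouville
import Literature.Analysis.FluidPDE.KNSSRegularityGalileanProofs
import Literature.Analysis.FluidPDE.OseenHeatKernelBridge
import Literature.Analysis.FluidPDE.KatoLocalBoundedPicard
import Literature.Analysis.FluidPDE.NSBoundedMildSmoothing
import HarnessLib

/-!
# Crux `TypeILiouville.TypeIliouvilleL` (stmt-NavierStokesRegularity-10661), line `registered`:
  STUB `stub_oseen_L3_modConst_propagation` — `L³` modulo a constant propagates forward along
  bounded Oseen-mild ancient solutions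

Let `v : ℝ → ℝ³ → ℝ³` be continuous and bounded on the open backward slab `(−∞,0) × ℝ³`, with weakly
divergence-free slices, solving the Oseen integral equation
`v(t) = e^{(t−s)Δ}v(s) − B¹_s(v,v)(t)` pointwise for all `s < t < 0` (the class of
`Literature.Analysis.FluidPDE.AlbrittonBarker2019_liouville_L3_backward`). If `v(s) − c ∈ L³(ℝ³)`
for a constant vector `c` and some `s < t < 0`, then `v(t) − c ∈ L³(ℝ³)` (qualitative propagation;
Lemarié-Rieusset 2016, Thm 9.12 with (7.32)–(7.33): locally in time a bounded mild solution is
Kato's `L³ ∩ L^∞` solution).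

Proof (everything from proved tree material, no named facts):

* `oseenModConst_isKNSSDriftMild_shift`: for a base time `s₀` the pair `(U, c)`,
  `U(τ, y) = v(τ + s₀, y) − c` (extended by `0` for `τ + s₀ ≥ 0`), is drift-mild on the window
  `(0, −s₀)` in the sense of KNSS 2009 Lemma 3.1 (`IsKNSSDriftMild`): the tensor
  `(U + c) ⊗ (U + c) = v ⊗ v` has the Duhamel integral `B¹(v,v)`
  (`driftDuhamel_zero_eq_oseenDuhamel`, `oseenDuhamel_translate`) and
  `e^{σΔ}(v − c) = e^{σΔ}v − c` (`heatExtension_sub_of_bound`, `heatExtension_const`);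
* Galilean covariance (`IsKNSSDriftMild.galileanCovariance_R3`) makes
  `W(τ, y) = v(τ + s₀, y + τ•c) − c` a bounded solution of the zero-drift Oseen integral equation
  (`IsKNSSDriftMild.eq_heatExtension_sub_oseenDuhamel_three`);
* `oseenModConst_exists_step_memLp`: with `s₀ = s − 1` the slice `W(1) = v(s, · + c) − c` lies in
  `L³ ∩ L^∞`; Oseen's scheme for bounded data with the `L³` norm carried along
  (`exists_oseen_fixedPoint_bounded`, lifespan `δ = (16 C A)⁻²`, `A = max K 0 + ‖c‖ + 1`) gives a
  bounded solution with `L³` slices from that datum, equal to `W(1 + ·)` a.e. by uniqueness of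
  bounded Oseen-mild solutions (`oseenMild_bounded_unique`); translating back (Lebesgue measure is
  translation invariant), `v(t) − c ∈ L³` whenever `t − s < δ`;
* `stub_oseen_L3_modConst_propagation`: finitely many steps of length `δ/2`.

No new definitions. Lands `--supports stmt-NavierStokesRegularity-10661`.
-/

noncomputable section

-- the problem namespace `Summit.NavierStokesRegularity.NavierStokesRegularity` repeats the summit
-- name by design (D-0017)
set_option linter.dupNamespace false

namespace Summit.NavierStokesRegularity.NavierStokesRegularity.Theorems

open MeasureTheory Filter Set Function
open Literature.Analysis Literature.Analysis.FluidPDE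
open scoped ENNReal

section Pieces

variable {v : ℝ → EuclideanSpace ℝ (Fin 3) → EuclideanSpace ℝ (Fin 3)} {K : ℝ}

/-- Slices of a field continuous on the open backward slab are continuous. -/
theorem oseenModConst_continuous_slice (hcont : ContinuousOn (uncurry v) (Iio 0 ×ˢ univ))
    {τ : ℝ} (hτ : τ < 0) : Continuous (v τ) :=
  hcont.comp_continuous (continuous_const.prodMk continuous_id) fun y => ⟨hτ, mem_univ y⟩

/-- Joint measurability of the time-shifted, constant-subtracted field, extended by zero past the
final time: `(τ, y) ↦ v(τ + s₀, y) − c` if `τ + s₀ < 0`, else `0`. -/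
theorem oseenModConst_measurable_uncurry_shift (hcont : ContinuousOn (uncurry v) (Iio 0 ×ˢ univ))
    (s₀ : ℝ) (c : EuclideanSpace ℝ (Fin 3)) :
    Measurable (uncurry fun τ y => if τ + s₀ < 0 then v (τ + s₀) y - c else 0) := by
  classical
  set S : Set (ℝ × EuclideanSpace ℝ (Fin 3)) := {p | p.1 + s₀ < 0} with hS_def
  have hS : MeasurableSet S := measurableSet_lt (measurable_fst.add_const _) measurable_const
  have hF : ContinuousOn (fun p : ℝ × EuclideanSpace ℝ (Fin 3) => v (p.1 + s₀) p.2 - c) S := by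
    have h1 : Continuous fun p : ℝ × EuclideanSpace ℝ (Fin 3) => (p.1 + s₀, p.2) :=
      (continuous_fst.add continuous_const).prodMk continuous_snd
    have hmaps : MapsTo (fun p : ℝ × EuclideanSpace ℝ (Fin 3) => (p.1 + s₀, p.2)) S
        (Iio 0 ×ˢ univ) := fun p hp => ⟨hp, mem_univ _⟩
    exact (hcont.comp h1.continuousOn hmaps).sub continuousOn_const
  have heq : (uncurry fun τ y => if τ + s₀ < 0 then v (τ + s₀) y - c else 0) =
      S.piecewise (fun p => v (p.1 + s₀) p.2 - c) 0 := by
    funext p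
    by_cases h : p.1 + s₀ < 0
    · have hp : p ∈ S := h
      simp [uncurry, Set.piecewise, hp, h]
    · have hp : p ∉ S := h
      simp [uncurry, Set.piecewise, hp, h]
  rw [heq]
  exact hF.measurable_piecewise continuousOn_const hS

/-- **The drift-mild pair of the shifted field.** If `v` is continuous and bounded by `K` on the
open backward slab, with weakly divergence-free slices, and solves the Oseen integral equation
`v(t) = e^{(t−s)Δ}v(s) − B¹_s(v,v)(t)` pointwise for all `s < t < 0`, then for every base time
`s₀` and constant `c` the pair `(U, c)`, `U(τ, y) = v(τ + s₀, y) − c` (extended by `0` for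
`τ + s₀ ≥ 0`), is drift-mild on the window `(0, −s₀)` in the sense of KNSS 2009, Lemma 3.1
(`IsKNSSDriftMild`): the tensor `(U + c) ⊗ (U + c) = v ⊗ v` has the zero-drift Duhamel integral
`B¹(v, v)` (`driftDuhamel_zero_eq_oseenDuhamel`, time-translated by `oseenDuhamel_translate`), and
`e^{σΔ}(v − c) = e^{σΔ}v − c`. -/
theorem oseenModConst_isKNSSDriftMild_shift (hcont : ContinuousOn (uncurry v) (Iio 0 ×ˢ univ))
    (hK : ∀ t < 0, ∀ x, ‖v t x‖ ≤ K) (hdiv : ∀ t < 0, IsWeaklyDivFree (v t))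
    (hmild : ∀ s t : ℝ, s < t → t < 0 → ∀ x,
      v t x = UnboundedOperators.heatExtension (v s) (t - s) x - oseenDuhamel 1 s v v t x)
    (c : EuclideanSpace ℝ (Fin 3)) (s₀ : ℝ) :
    IsKNSSDriftMild (-s₀) (max K 0 + ‖c‖)
      (fun τ y => if τ + s₀ < 0 then v (τ + s₀) y - c else 0) (fun _ => c) := by
  set U : ℝ → EuclideanSpace ℝ (Fin 3) → EuclideanSpace ℝ (Fin 3) :=
    fun τ y => if τ + s₀ < 0 then v (τ + s₀) y - c else 0 with hU
  have hUeq : ∀ {τ : ℝ}, τ + s₀ < 0 → U τ = fun y => v (τ + s₀) y - c := fun h => by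
    funext y; simp [hU, h]
  have hslice : ∀ {τ : ℝ}, τ < 0 → Continuous (v τ) := fun hτ =>
    oseenModConst_continuous_slice hcont hτ
  refine
    { measurable_drift := measurable_const
      norm_drift_le := fun _ => le_add_of_nonneg_left (le_max_right _ _)
      measurable := oseenModConst_measurable_uncurry_shift hcont s₀ c
      norm_le := fun t ht x => ?_
      ae_isWeaklyDivFree := ?_
      mild := fun s t hs hst ht x => ?_ }
  · -- the bound
    have h : t + s₀ < 0 := by linarith [ht.2]
    rw [hUeq h]
    calc ‖v (t + s₀) x - c‖ ≤ ‖v (t + s₀) x‖ + ‖c‖ := norm_sub_le _ _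
      _ ≤ max K 0 + ‖c‖ := by
          gcongr
          exact (hK _ h x).trans (le_max_left _ _)
  · -- weak divergence-freeness of every slice of the window
    refine (ae_restrict_iff' measurableSet_Ioo).2 (Eventually.of_forall fun t ht => ?_)
    have h : t + s₀ < 0 := by linarith [ht.2]
    have hc : IsWeaklyDivFree (fun _ : EuclideanSpace ℝ (Fin 3) => c) :=
      VectorCalculus.IsDivFree.isWeaklyDivFree_holds
        (fun x => by simp [VectorCalculus.divergence]) contDiff_const
    have hvm : MemLp (v (t + s₀)) ∞ volume :=
      memLp_top_of_bound (hslice h).aestronglyMeasurable K (Eventually.of_forall (hK _ h))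
    have hsub := IsWeaklyDivFree.sub (p := ∞) le_top (hdiv _ h) hc hvm (memLp_top_const c)
    have e : U t = v (t + s₀) - fun _ => c := by rw [hUeq h]; rfl
    rw [e]
    exact hsub
  · -- the drift-mild identity
    have hs' : s + s₀ < 0 := by linarith
    have ht' : t + s₀ < 0 := by linarith
    have hE : Module.finrank ℝ (EuclideanSpace ℝ (Fin 3)) = 3 := finrank_euclideanSpace_fin
    -- the full velocity `V = U + c = v(· + s₀)` on the window
    set V : ℝ → EuclideanSpace ℝ (Fin 3) → EuclideanSpace ℝ (Fin 3) := fun τ y => U τ y + c with hV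
    have hVeq : ∀ {τ : ℝ}, τ + s₀ < 0 → V τ = v (τ + s₀) := fun h => by
      funext y; simp [hV, hUeq h]
    have hT : driftTensor U (fun _ => c) = driftTensor V 0 := by
      funext σ j k y
      simp [driftTensor_apply, hV]
    have hD : driftDuhamel U (fun _ => c) s t x = driftDuhamel V 0 s t x := by
      rw [driftDuhamel_apply, driftDuhamel_apply, hT]
    have hVm : ∀ σ ∈ Ioo s t, Measurable (V σ) := fun σ hσ => by
      rw [hVeq (by linarith [hσ.2])]
      exact (hslice (by linarith [hσ.2])).measurable
    have hVN : ∀ σ ∈ Ioo s t, ∀ y, ‖V σ y‖ ≤ K := fun σ hσ y => by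
      rw [hVeq (by linarith [hσ.2])]
      exact hK _ (by linarith [hσ.2]) y
    have hD0 : driftDuhamel V 0 s t x = oseenDuhamel 1 s V V t x :=
      driftDuhamel_zero_eq_oseenDuhamel hE hVm hVN hst.le x
    have hD1 : oseenDuhamel 1 s V V t x =
        oseenDuhamel 1 s (fun τ => v (τ + s₀)) (fun τ => v (τ + s₀)) t x := by
      simp only [oseenDuhamel_apply]
      refine setIntegral_congr_fun measurableSet_Ioo fun τ hτ => ?_
      simp only [hVeq (show τ + s₀ < 0 by linarith [hτ.2])]
    have hD2 := oseenDuhamel_translate 1 s s₀ v v t x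
    -- the caloric term
    have hH : UnboundedOperators.heatExtension (U s) (t - s) x =
        UnboundedOperators.heatExtension (v (s + s₀)) (t - s) x - c := by
      rw [hUeq hs', UnboundedOperators.heatExtension_sub_of_bound (hslice hs') continuous_const
        (hK _ hs') (fun _ => le_rfl) (sub_pos.2 hst) x,
        UnboundedOperators.heatExtension_const c (sub_pos.2 hst) x]
    have hm := hmild (s + s₀) (t + s₀) (by linarith) ht' x
    rw [add_sub_add_right_eq_sub] at hm
    rw [hD, hD0, hD1, hD2, hH, show U t x = v (t + s₀) x - c by simp [hUeq ht'], hm]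
    abel

/-- **One short step of `L³` propagation modulo a constant.** Under the hypotheses of
`oseenModConst_isKNSSDriftMild_shift` there is a step length `δ > 0`, depending only on the bound
`K` and on `‖c‖`, such that `v(s) − c ∈ L³ ⇒ v(t) − c ∈ L³` whenever `s < t < 0` and `t − s < δ`.
Mechanism: in the Galilean frame moving with the constant drift `c`
(`IsKNSSDriftMild.galileanCovariance_R3`) the field `W(τ, y) = v(τ + s₀, y + τ•c) − c`,
`s₀ = s − 1`, is a bounded solution of the zero-drift Oseen integral equation
(`IsKNSSDriftMild.eq_heatExtension_sub_oseenDuhamel_three`); its slice at `τ = 1` is a translate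
of `v(s) − c ∈ L³ ∩ L^∞`, so Oseen's scheme (`exists_oseen_fixedPoint_bounded`, `p = 3`, lifespan
`δ = (16 C A)⁻²`, `A = max K 0 + ‖c‖ + 1`) produces a bounded solution with slices in `L³` from
that datum, which agrees with `W(1 + ·)` a.e. by uniqueness of bounded solutions
(`oseenMild_bounded_unique`); translating back, `v(t) − c ∈ L³`. -/
theorem oseenModConst_exists_step_memLp (hcont : ContinuousOn (uncurry v) (Iio 0 ×ˢ univ))
    (hK : ∀ t < 0, ∀ x, ‖v t x‖ ≤ K) (hdiv : ∀ t < 0, IsWeaklyDivFree (v t))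
    (hmild : ∀ s t : ℝ, s < t → t < 0 → ∀ x,
      v t x = UnboundedOperators.heatExtension (v s) (t - s) x - oseenDuhamel 1 s v v t x)
    (c : EuclideanSpace ℝ (Fin 3)) :
    ∃ δ : ℝ, 0 < δ ∧ ∀ s t : ℝ, s < t → t < 0 → t - s < δ →
      MemLp (fun x => v s x - c) 3 (volume : Measure (EuclideanSpace ℝ (Fin 3))) →
      MemLp (fun x => v t x - c) 3 (volume : Measure (EuclideanSpace ℝ (Fin 3))) := by
  obtain ⟨C, hC, hscheme⟩ :=
    exists_oseen_fixedPoint_bounded (E := EuclideanSpace ℝ (Fin 3)) (p := 3) (by norm_num)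
      (by norm_num)
  set N : ℝ := max K 0 + ‖c‖ with hN
  have hN0 : 0 ≤ N := by positivity
  set A : ℝ := N + 1 with hA
  have hA0 : 0 < A := by positivity
  have hNA : N ≤ A := by linarith
  set δ : ℝ := (1 / (16 * C * A)) ^ 2 with hδ
  have hδ0 : 0 < δ := by positivity
  have hsmall : C * A * (1 : ℝ) ^ (-(1 / 2 : ℝ)) * (2 * Real.sqrt δ) ≤ 1 / 8 := by
    rw [Real.one_rpow, hδ, Real.sqrt_sq (by positivity)]
    refine le_of_eq ?_
    field_simp
    ring
  refine ⟨δ, hδ0, fun s t hst ht0 hts hmem => ?_⟩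
  -- the base time `s₀ = s - 1`, the shifted drift-mild pair and its Galilean image
  set s₀ : ℝ := s - 1 with hs₀
  set U : ℝ → EuclideanSpace ℝ (Fin 3) → EuclideanSpace ℝ (Fin 3) :=
    fun τ y => if τ + s₀ < 0 then v (τ + s₀) y - c else 0 with hU
  have hUeq : ∀ {τ : ℝ}, τ + s₀ < 0 → U τ = fun y => v (τ + s₀) y - c := fun h => by
    funext y; simp [hU, h]
  have hDM : IsKNSSDriftMild (-s₀) N U (fun _ => c) :=
    oseenModConst_isKNSSDriftMild_shift hcont hK hdiv hmild c s₀
  have hG : IsKNSSDriftMild (-s₀) N (galileanShift U fun _ => c) 0 :=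
    IsKNSSDriftMild.galileanCovariance_R3 hDM
  set W : ℝ → EuclideanSpace ℝ (Fin 3) → EuclideanSpace ℝ (Fin 3) := galileanShift U fun _ => c
    with hW
  have hWeq : ∀ {τ : ℝ}, τ + s₀ < 0 → W τ = fun y => v (τ + s₀) (y + τ • c) - c := fun {τ} h => by
    funext y
    simp only [hW, galileanShift_apply, driftPath, intervalIntegral.integral_const, sub_zero]
    rw [hUeq h]
  -- the datum at frame time `1` (physical time `s`)
  have h1s : (1 : ℝ) + s₀ = s := by rw [hs₀]; ring
  have hs0 : s < 0 := hst.trans ht0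
  have h1T : (1 : ℝ) ∈ Ioo 0 (-s₀) := ⟨one_pos, by rw [hs₀]; linarith⟩
  set a : EuclideanSpace ℝ (Fin 3) → EuclideanSpace ℝ (Fin 3) := W 1 with ha
  have ha_eq : a = fun y => v s (y + c) - c := by
    rw [ha, hWeq (by rw [h1s]; exact hs0)]
    simp only [h1s, one_smul]
  have ha_meas : AEStronglyMeasurable a volume :=
    (hG.measurable.comp (measurable_const.prodMk measurable_id)).aestronglyMeasurable
  have ha_bd : ∀ y, ‖a y‖ ≤ A := fun y => (hG.norm_le 1 h1T y).trans hNA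
  have ha_3 : MemLp a 3 volume := by
    rw [ha_eq]
    exact hmem.comp_measurePreserving (measurePreserving_add_right volume c)
  -- Oseen's scheme from the datum `a` on `(0, δ)`
  obtain ⟨u, hum, hubd, hu3, huslice, hueq⟩ := hscheme one_pos hδ0 hA0 ha_meas ha_bd ha_3 hsmall
  -- uniqueness on `(0, T')`, `T' = min δ (-s)`
  set T' : ℝ := min δ (-s) with hT'
  have hT'δ : T' ≤ δ := min_le_left _ _
  have hT's : T' ≤ -s := min_le_right _ _
  have hwin : ∀ {τ : ℝ}, τ ∈ Ioo 0 T' → τ + 1 ∈ Ioo 0 (-s₀) := fun {τ} hτ =>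
    ⟨by linarith [hτ.1], by rw [hs₀]; linarith [hτ.2, hT's]⟩
  have key : ∀ τ ∈ Ioo 0 T', u τ =ᵐ[volume] (fun σ => W (σ + 1)) τ := by
    refine oseenMild_bounded_unique (E := EuclideanSpace ℝ (Fin 3)) (ν := 1) (s := 0) (T := T')
      (M := 2 * A)
      (U := fun τ x => UnboundedOperators.heatExtension a (1 * τ) x) one_pos (by positivity)
      (hum.mono_measure (Measure.restrict_mono (prod_mono (Ioo_subset_Ioo_right hT'δ)
        Subset.rfl) le_rfl))
      (hG.measurable.comp ((measurable_fst.add_const 1).prodMk measurable_snd)).aestronglyMeasurable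
      (fun τ hτ y => hubd τ ⟨hτ.1, hτ.2.trans_le hT'δ⟩ y)
      (fun τ hτ y => (hG.norm_le (τ + 1) (hwin hτ) y).trans (by linarith))
      (fun τ hτ => Eventually.of_forall fun x => hueq τ ⟨hτ.1, hτ.2.trans_le hT'δ⟩ x)
      (fun τ hτ => Eventually.of_forall fun x => ?_)
    have h := (hG.eq_heatExtension_sub_oseenDuhamel_three (s := 1) (t := τ + 1) one_pos
      (by linarith [hτ.1]) (hwin hτ).2).1 x
    show W (τ + 1) x = UnboundedOperators.heatExtension a (1 * τ) x -
      oseenDuhamel 1 0 (fun σ => W (σ + 1)) (fun σ => W (σ + 1)) τ x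
    rw [oseenDuhamel_translate 1 0 1 W W τ x, zero_add, one_mul, h, ha, add_sub_cancel_right]
  -- at frame time `t - s + 1` (physical time `t`)
  have hτ : t - s ∈ Ioo 0 T' := ⟨sub_pos.2 hst, lt_min hts (by linarith)⟩
  have hmemu : MemLp (u (t - s)) 3 volume :=
    ⟨huslice _ ⟨hτ.1, hτ.2.trans_le hT'δ⟩, (hu3 _ ⟨hτ.1, hτ.2.trans_le hT'δ⟩).trans_lt
      (ENNReal.mul_lt_top (by simp) ha_3.eLpNorm_lt_top)⟩
  have hmemW : MemLp (W (t - s + 1)) 3 volume := hmemu.ae_eq (key _ hτ)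
  have hts₀ : t - s + 1 + s₀ = t := by rw [hs₀]; ring
  rw [hWeq (by rw [hts₀]; exact ht0)] at hmemW
  simp only [hts₀] at hmemW
  have h := hmemW.comp_measurePreserving (measurePreserving_sub_right volume ((t - s + 1) • c))
  convert h using 1
  funext y
  simp [sub_add_cancel]

end Pieces

/-- **Stub 2d (`L³` modulo a constant propagates forward along bounded Oseen-mild solutions).**
If `v` is continuous and bounded on `(−∞,0) × ℝ³` with weakly divergence-free slices and solves the
Oseen integral equation `v(t) = e^{(t−s)Δ}v(s) − B¹_s(v,v)(t)` pointwise for all `s < t < 0`, and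
`v(s) − c ∈ L³` for some `s < t < 0` and a constant `c`, then `v(t) − c ∈ L³`. Proof: finitely many
steps of the fixed length `δ/2` of `oseenModConst_exists_step_memLp` (Kato's `L³ ∩ L^∞` local
theory in the Galilean frame of the constant drift `c` + uniqueness of bounded Oseen-mild solutions;
Lemarié-Rieusset 2016, Thm 9.12, (7.32)–(7.33)). -/
theorem stub_oseen_L3_modConst_propagation :
    ∀ (v : ℝ → EuclideanSpace ℝ (Fin 3) → EuclideanSpace ℝ (Fin 3))
      (c : EuclideanSpace ℝ (Fin 3)) (s t : ℝ), s < t → t < 0 →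
      ContinuousOn (uncurry v) (Iio 0 ×ˢ univ) →
      (∃ K : ℝ, ∀ t < 0, ∀ x, ‖v t x‖ ≤ K) →
      (∀ t < 0, Literature.Analysis.FluidPDE.IsWeaklyDivFree (v t)) →
      (∀ s t : ℝ, s < t → t < 0 → ∀ x,
        v t x = Literature.Analysis.UnboundedOperators.heatExtension (v s) (t - s) x -
          Literature.Analysis.FluidPDE.oseenDuhamel 1 s v v t x) →
      MemLp (fun x => v s x - c) 3 (volume : Measure (EuclideanSpace ℝ (Fin 3))) →
      MemLp (fun x => v t x - c) 3 (volume : Measure (EuclideanSpace ℝ (Fin 3))) := by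
  intro v c s t hst ht0 hcont hK hdiv hmild hmem
  obtain ⟨K, hK⟩ := hK
  obtain ⟨δ, hδ, hstep⟩ := oseenModConst_exists_step_memLp hcont hK hdiv hmild c
  -- induction over steps of length `δ / 2`
  have hind : ∀ n : ℕ, ∀ t' : ℝ, s ≤ t' → t' < 0 → t' - s ≤ n * (δ / 2) →
      MemLp (fun x => v t' x - c) 3 (volume : Measure (EuclideanSpace ℝ (Fin 3))) := by
    intro n
    induction n with
    | zero =>
        intro t' hst' ht'0 hle
        obtain rfl : t' = s := by
          simp only [Nat.cast_zero, zero_mul, sub_nonpos] at hle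
          exact le_antisymm hle hst'
        exact hmem
    | succ n ih =>
        intro t' hst' ht'0 hle
        by_cases h : t' - s ≤ n * (δ / 2)
        · exact ih t' hst' ht'0 h
        · push Not at h
          have hn0 : (0 : ℝ) ≤ n * (δ / 2) := by positivity
          set t'' : ℝ := max s (t' - δ / 2) with ht''
          have h1 : s ≤ t'' := le_max_left _ _
          have h2 : t'' < t' := max_lt (by linarith) (by linarith)
          have h3 : t'' - s ≤ n * (δ / 2) := by
            rcases le_total s (t' - δ / 2) with hle' | hle'
            · rw [ht'', max_eq_right hle']
              push_cast [Nat.cast_succ] at hle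
              linarith
            · rw [ht'', max_eq_left hle', sub_self]
              exact hn0
          have h4 : t' - t'' < δ := by
            have : t' - δ / 2 ≤ t'' := le_max_right _ _
            linarith
          exact hstep t'' t' h2 ht'0 h4 (ih t'' h1 (h2.trans ht'0) h3)
  obtain ⟨n, hn⟩ := exists_nat_ge ((t - s) / (δ / 2))
  exact hind n t hst.le ht0 (by rwa [div_le_iff₀ (by positivity)] at hn)

end Summit.NavierStokesRegularity.NavierStokesRegularity.Theorems

end
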